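import Literature.NumberTheory.Automorphic.ThorneQInfinityModular
import Literature.NumberTheory.Automorphic.TotallyRealModularityX0Fifteen
import Literature.NumberTheory.Automorphic.SolvableBaseChangeModularity
import Literature.NumberTheory.Automorphic.SolvableBaseChangeModularityProofs
import Literature.NumberTheory.Automorphic.FLSResidualImageCriteria
import Literature.NumberTheory.EllipticCurves.IsogenyHasCMProofs
import Literature.NumberTheory.EllipticCurves.TorsionPointHauptmodul
import Literature.NumberTheory.EllipticCurves.XZeroFifteenExplicit
import Literature.NumberTheory.EllipticCurves.XsThreeBFiveExplicit
import HarnessLib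

/-!
# Thorne 2019, Lemma 3 (2): the two vendorings are one debt, and the printed proof formalized
# modulo its inputs (proofs only)

Sibling PROOFS file of `ThorneQInfinityModular.lean` (no definitions, no named facts; D-0014 /
D-0026). Thorne's Lemma 3 (2) with Prop. 4 — J. A. Thorne, *Elliptic curves over `ℚ_∞` are
modular*, J. Eur. Math. Soc. 21 (2019) 1943–1948 = arXiv:1505.04769 [Thorne2019], p. 1945 of the
journal (p. 4 of the held text `paper:arxiv-1505.04769`): "Let `F` be a totally real field such that
`√5 ∉ F`. • If `E` is an elliptic curve over `F` which is not modular, then `E` determines an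
`F`-rational point of one of the curves `X(s3, b5)`, `X(b3, b5)`. • If `F/ℚ` is cyclic and
`X(s3, b5)(F) = X(s3, b5)(ℚ)`, `X(b3, b5)(F) = X(b3, b5)(ℚ)`, then all elliptic curves over `F` are
modular. *Proof.* The first part is a consequence of Theorem 2 and [Fre13]. The second part is a
consequence of the first part, the modularity of all elliptic curves over `ℚ`, and cyclic base
change for `GL₂` [Lan80]." — was vendored TWICE on 2026-08-17 by two parallel seats of route
`Langlands/HeptagonalTower`:

* `Thorne2019_lemma3` (`ThorneQInfinityModular.lean`): hypotheses `Thorne2019.PointsRational E₁ K`,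
  `Thorne2019.PointsRational E₂ K` (every affine `K`-point satisfying the EQUATION of
  `E₁ = [1,1,1,-10,-10]`, resp. `E₂ = [1,1,1,-5,2]`, has rational coordinates), `IsTotallyReal K` as an
  explicit hypothesis, conclusion the WEAK trace-only `IsModularEllipticCurve K E` (Caraiani–Newton);
* `Thorne2019_lemma3_2` (`TotallyRealModularityX0Fifteen.lean`): the same hypotheses phrased with
  `Nonsingular` affine points of `Thorne2019.curveE1`, `Thorne2019.curveE2`, `[IsTotallyReal F]` as
  an instance, conclusion the STRONG `IsAutomorphicOfWeightZero E` (Hecke polynomial at every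
  `w ∤ Δ(E)`).

## Contents

1. `Thorne2019_lemma3_of_lemma3_2`: the first is a COROLLARY of the second, so that the two
   `def … : Prop` carry ONE unit of debt: the two pairs of models are syntactically equal
   (`Thorne2019.curveE1_eq_E₁`, `Thorne2019.curveE2_eq_E₂`, both `rfl`), on the elliptic curves
   `E₁`, `E₂` an affine point satisfies the equation iff it is nonsingular
   (`Thorne2019.pointsRational_iff_nonsingular`), and `IsAutomorphicOfWeightZero E →
   IsModularEllipticCurve K E` is the proved bridge of `TotallyRealModularity.lean`.
2. `Thorne2019_lemma3_of_moduli`: **the printed proof of Lemma 3 (2), sorry-free modulo exactly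
   its printed inputs**, each either an EXISTING named fact of the tree or an explicit hypothesis:
   * "Theorem 2 and [Fre13]" (part (1) up to the moduli interpretation: a non-modular `E` over a
     totally real `K` with `√5 ∉ K` has mod-`3` image in `B(3)` or `C_s⁺(3)` and mod-`5` image in
     `B(5)`) = the named fact `Box2022_theorem1_3` (i)–(ii) (`TotallyRealModularityBoxImages.lean`;
     Box prints it as a corollary of Thorne's Thm. 2 / FLHS);
   * "the modularity of all elliptic curves over `ℚ`, and cyclic base change for `GL₂` [Lan80]"
     (+ quadratic twists) = the named facts `isModularEllipticCurve_baseChange_rat_of_isSolvable`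
     (BCDT Thm. A + Langlands, iterated along the cyclic — hence solvable — `K/ℚ`) and
     `isModularEllipticCurve_of_jInvariant_eq` (`SolvableBaseChangeModularity.lean`), through the
     proved `isModularEllipticCurve_of_jInvariant_eq_ratCast`;
   * the MODULI INTERPRETATION of `X(b3, b5) = X₀(15) ≅_ℚ E₁` and `X(s3, b5) ≅_ℚ E₂` (Prop. 4;
     [Fre13] §§2–3: "a non-cuspidal point on `X` gives rise to a well-defined `j`-invariant";
     Box 2022 §1.1: "if `Im(ρ̄_{E,N}) ⊂ G` up to conjugation, then there exists `Q ∈ Y_G(K)` with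
     `j(Q) = j_E`") has NO carrier in the tree or in Mathlib and enters as the two explicit
     hypotheses `hX₁`, `hX₂`, in the weakest form the argument needs: there are a finite set
     `S ⊂ ℚ` and polynomials `Jn, Jd ∈ ℚ[x, y]` (a presentation of the `ℚ`-rational `j`-map on the
     affine model, `S` = the rational `j`-values carried by the point at infinity, if it is not a
     cusp) such that every `E / K` with the relevant level structures has `j(E) ∈ S` or
     `j(E) = Jn(P)/Jd(P)` for an affine `K`-point `P` of `E₁` (resp. `E₂`) with `Jd(P) ≠ 0` — a TRUE
     statement, not proved here (the cusps form a Galois-stable finite set of points whose sum is a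
     rational, hence torsion, point of `Eᵢ(ℚ) ≅ ℤ/2 ⊕ ℤ/4`, so some `Jd ∈ ℚ[x, y]` vanishes on the
     affine curve exactly at the affine cusps, to high order; put `Jn = j · Jd`, a function regular
     off `O`, i.e. a polynomial, and `S = {j(O)}` if `O` is not a cusp);
   * the `CM` escape of the weak rendering for `j ∈ {0, 1728}` (where twist invariance is not the
     quadratic one) is the tree's `WeierstrassCurve.HasCM.of_j_eq_zero` / `.of_j_eq_1728`
     (`IsogenyHasCMProofs.lean`: curves with `j = 0` or `1728` have geometric CM over any field).
   So `Thorne2019_lemma3` (and `Thorne2019_lemma3_2` in its weak form) is reduced to three existing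
   named facts and the moduli interpretation of two genus-one modular curves; the case `K = ℚ` of
   the lemma alone is Wiles–Breuil–Conrad–Diamond–Taylor, so no discharge is attempted (triage XL).

## References

* [Thorne2019] J. A. Thorne, J. Eur. Math. Soc. 21 (2019) 1943–1948, doi:10.4171/jems/877, Lemma 3
  and Prop. 4 (p. 4 of the held text `paper:arxiv-1505.04769`).
* [FreitasLeHungSiksek2015] Invent. Math. 201 (2015) 159–206, §2 (p. 9 of the held text
  arXiv:1310.7088), §3 (p. 21), Lemmas 5.6–5.7; [Box2022] Trans. AMS 375 (2022), §1.1 and Thm. 1.3;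
  [SilvermanAEC2009] Thm. III.10.1 (CM for `j = 0, 1728`, tree file `IsogenyHasCMProofs.lean`).
-/

noncomputable section

namespace Literature.NumberTheory.Automorphic

open scoped _root_.NumberField MatrixGroups
open _root_.NumberField _root_.Field Literature.NumberTheory.GaloisRepresentations

/-! ### 1. The two vendorings of Lemma 3 (2) are one debt -/

namespace Thorne2019

/-- The two vendored copies of Thorne's `E₁ = [1, 1, 1, -10, -10]` (15A1 `≅ X(b3, b5) = X₀(15)`)
are the same Weierstrass curve. [cite: Thorne2019, Prop. 4] -/
theorem curveE1_eq_E₁ : curveE1 = E₁ := rfl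

/-- The two vendored copies of Thorne's `E₂ = [1, 1, 1, -5, 2]` (15A3 `≅ X(s3, b5)`) are the same
Weierstrass curve. [cite: Thorne2019, Prop. 4] -/
theorem curveE2_eq_E₂ : curveE2 = E₂ := rfl

/-- On a Weierstrass curve over `ℚ` with `Δ ≠ 0`, "every affine `K`-point on the curve has rational
coordinates" (`PointsRational`, phrased with `Equation`) is the same as the `Nonsingular`-phrased
condition used by `Thorne2019_lemma3_2` / `Yoshikawa2022_corollary3_3_1`: on an elliptic curve every
affine point satisfying the equation is nonsingular (Mathlib
`WeierstrassCurve.Affine.equation_iff_nonsingular_of_Δ_ne_zero`). [folklore] -/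
theorem pointsRational_iff_nonsingular (W : WeierstrassCurve ℚ) (hW : W.Δ ≠ 0) (K : Type) [Field K]
    [Algebra ℚ K] :
    PointsRational W K ↔
      ∀ x y : K, (W.baseChange K).toAffine.Nonsingular x y →
        x ∈ Set.range (algebraMap ℚ K) ∧ y ∈ Set.range (algebraMap ℚ K) := by
  have hΔ : (W.baseChange K).Δ ≠ 0 := by
    rw [WeierstrassCurve.baseChange, WeierstrassCurve.map_Δ]
    exact (map_ne_zero (algebraMap ℚ K)).2 hW
  refine ⟨fun h x y hxy => h x y hxy.1, fun h x y hxy => h x y ?_⟩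
  exact (WeierstrassCurve.Affine.equation_iff_nonsingular_of_Δ_ne_zero (W := W.baseChange K) hΔ).1
    hxy

/-- `Δ(E₁) ≠ 0`. [folklore] -/
theorem E₁_Δ_ne_zero : E₁.Δ ≠ 0 := by
  rw [E₁_Δ]; norm_num

/-- `Δ(E₂) ≠ 0`. [folklore] -/
theorem E₂_Δ_ne_zero : E₂.Δ ≠ 0 := by
  rw [E₂_Δ]; norm_num

end Thorne2019

/-- **The two vendorings of Thorne 2019, Lemma 3 (2) are one debt**: the named fact
`Thorne2019_lemma3_2` (`TotallyRealModularityX0Fifteen.lean`: `Nonsingular`-phrased point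
hypotheses on `curveE1 = E₁`, `curveE2 = E₂`, conclusion `IsAutomorphicOfWeightZero`) implies the
named fact `Thorne2019_lemma3` (`ThorneQInfinityModular.lean`: `PointsRational E₁ K`,
`PointsRational E₂ K`, conclusion the weak `IsModularEllipticCurve K E`), through the proved bridge
`Thorne2019_lemma3_2.isModularEllipticCurve` (`IsAutomorphicOfWeightZero ⟹ IsHilbertModular ⟹
IsModularEllipticCurve`, `TotallyRealModularity.lean`) and `Nonsingular ⟹ Equation`. Users of
`(h : Thorne2019_lemma3)` (route `Langlands/HeptagonalTower`, crux `OddDegreeDoor`) may therefore take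
`(h : Thorne2019_lemma3_2)` instead. [cite: Thorne2019, Lemma 3 (2) and Prop. 4] -/
theorem Thorne2019_lemma3_of_lemma3_2 (h : Thorne2019_lemma3_2) : Thorne2019_lemma3 := by
  intro K _ _ hK h5 hG hC h₁ h₂ E hΔ
  haveI := hK
  exact h.isModularEllipticCurve K h5 hG hC (fun x y hxy => h₁ x y hxy.1)
    (fun x y hxy => h₂ x y hxy.1) E hΔ

/-- The same bridge with the hypotheses of `Thorne2019_lemma3` spelled out: granted
`Thorne2019_lemma3_2`, over a cyclic totally real number field `K` with `√5 ∉ K` in which `E₁` and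
`E₂` have only rational points, every integral Weierstrass model with `Δ ≠ 0` is modular in the
Caraiani–Newton sense. [cite: Thorne2019, Lemma 3 (2) and Prop. 4] -/
theorem Thorne2019_lemma3_2.isModularEllipticCurve_of_pointsRational (h : Thorne2019_lemma3_2)
    (K : Type) [Field K] [NumberField K] (hK : IsTotallyReal K) (h5 : ¬ IsSquare (5 : K))
    (hG : IsGalois ℚ K) (hC : IsCyclic (K ≃ₐ[ℚ] K))
    (h₁ : Thorne2019.PointsRational Thorne2019.E₁ K) (h₂ : Thorne2019.PointsRational Thorne2019.E₂ K)
    (E : WeierstrassCurve (𝓞 K)) (hΔ : E.Δ ≠ 0) : IsModularEllipticCurve K E :=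
  Thorne2019_lemma3_of_lemma3_2 h K hK h5 hG hC h₁ h₂ E hΔ

/-! ### 2a. Bookkeeping: the `j`-invariant of an integral model, and rationality of `j` from a
rational point -/

/-- The `j`-invariant of the elliptic curve `E ⊗ K` of an integral model `E / 𝓞 K` is
`c₄(E)³ / Δ(E)` read in `K` (Silverman, *AEC*, III.1: `j = c₄³ / Δ`; the expression used by
`isModularEllipticCurve_of_jInvariant_eq` and `FLS2015_theorem5`). [folklore] -/
theorem j_baseChange_eq_div {K : Type} [Field K] [NumberField K] {E : WeierstrassCurve (𝓞 K)}
    (hΔ : E.Δ ≠ 0) :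
    (letI := FLS2015.isElliptic_baseChange hΔ
     (E.baseChange K).j) = (algebraMap (𝓞 K) K E.c₄) ^ 3 / algebraMap (𝓞 K) K E.Δ := by
  letI := FLS2015.isElliptic_baseChange hΔ
  have hc : (E.baseChange K).c₄ = algebraMap (𝓞 K) K E.c₄ := by
    rw [WeierstrassCurve.baseChange, WeierstrassCurve.map_c₄]
  have hd : (E.baseChange K).Δ = algebraMap (𝓞 K) K E.Δ := by
    rw [WeierstrassCurve.baseChange, WeierstrassCurve.map_Δ]
  rw [WeierstrassCurve.j, Units.val_inv_eq_inv_val, WeierstrassCurve.coe_Δ', hc, hd,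
    div_eq_mul_inv, mul_comm]

namespace Thorne2019

/-- **A rational point forces a rational `j`-value.** If every affine `K`-point of the curve `W/ℚ`
has rational coordinates (`PointsRational W K`) and `j · Jd(x, y) = Jn(x, y)` with `Jd(x, y) ≠ 0`
for an affine `K`-point `(x, y)` of `W` and polynomials `Jn, Jd ∈ ℚ[x, y]`, then `j ∈ ℚ`: a
`ℚ`-rational function takes rational values at rational points. This is the step "that point is
rational, so `j(E) ∈ ℚ`" of Thorne's proof of Lemma 3 (2). [cite: Thorne2019, Lemma 3 (proof)] -/
theorem exists_ratCast_eq_of_pointsRational {W : WeierstrassCurve ℚ} {K : Type} [Field K]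
    [NumberField K] (hW : PointsRational W K) {Jn Jd : MvPolynomial (Fin 2) ℚ} {j x y : K}
    (hxy : (W.baseChange K).toAffine.Equation x y) (hJd : MvPolynomial.aeval ![x, y] Jd ≠ 0)
    (hJ : j * MvPolynomial.aeval ![x, y] Jd = MvPolynomial.aeval ![x, y] Jn) :
    ∃ j₀ : ℚ, j = (j₀ : K) := by
  obtain ⟨⟨qx, rfl⟩, ⟨qy, rfl⟩⟩ := hW x y hxy
  have hv : (![algebraMap ℚ K qx, algebraMap ℚ K qy] : Fin 2 → K) = algebraMap ℚ K ∘ ![qx, qy] := by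
    funext i
    fin_cases i <;> rfl
  have hev : ∀ P : MvPolynomial (Fin 2) ℚ,
      MvPolynomial.aeval ![algebraMap ℚ K qx, algebraMap ℚ K qy] P =
        ((MvPolynomial.aeval ![qx, qy] P : ℚ) : K) := fun P => by
    rw [hv, MvPolynomial.aeval_algebraMap_apply, eq_ratCast]
  rw [hev] at hJd hJ
  rw [hev] at hJ
  refine ⟨MvPolynomial.aeval ![qx, qy] Jn / MvPolynomial.aeval ![qx, qy] Jd, ?_⟩
  rw [Rat.cast_div, eq_div_iff hJd, hJ]

end Thorne2019

/-! ### 2b. Thorne's proof of Lemma 3 (2), modulo its inputs -/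

/-- **Thorne 2019, Lemma 3 (2) — the printed proof, sorry-free modulo exactly its printed
inputs.** Granted
* `hBox : Box2022_theorem1_3` — the named fact rendering "Theorem 2 and [Fre13]" (a non-modular `E`
  over a totally real `K` has a framing of `E[3]` with image in `B(3)` or in
  `C_s⁺(3) = ⟨diag(1,2), (0 1; 1 0)⟩`, and, if `√5 ∉ K`, a framing of `E[5]` with image in `B(5)`);
* `hBC : isModularEllipticCurve_baseChange_rat_of_isSolvable` and
  `hTw : isModularEllipticCurve_of_jInvariant_eq` — the named facts rendering "the modularity of all
  elliptic curves over `ℚ` [BCDT], and cyclic base change for `GL₂` [Lan80]" together with the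
  invariance of modularity under quadratic twist (`j ∉ {0, 1728}`);
* `hX₁`, `hX₂` — the MODULI INTERPRETATION of `X(b3, b5) = X₀(15) ≅_ℚ E₁` and `X(s3, b5) ≅_ℚ E₂`
  (Prop. 4; [Fre13] §§2–3, Box 2022 §1.1), stated in the weakest form used: a finite set `S ⊂ ℚ` and
  polynomials `Jn, Jd ∈ ℚ[x, y]` such that every `E / K` (`K` a number field, `Δ(E) ≠ 0`) with a
  `B(3)`-framing (resp. a `C_s⁺(3)`-framing) of `E[3]` and a `B(5)`-framing of `E[5]` has
  `j(E) = c₄³/Δ ∈ S` or `j(E) · Jd(P) = Jn(P)`, `Jd(P) ≠ 0`, for some affine `K`-point `P` of `E₁`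
  (resp. `E₂`) — no carrier for modular curves as moduli spaces exists in the tree or in Mathlib;
then `Thorne2019_lemma3` holds. *Proof* (Thorne, loc. cit.): let `K` be totally real and cyclic over
`ℚ` with `√5 ∉ K`, `E₁(K) = E₁(ℚ)`, `E₂(K) = E₂(ℚ)`, and suppose `E / 𝓞 K` (`Δ ≠ 0`) is not modular.
Then `E` is not automorphic of weight zero (proved bridges of `TotallyRealModularity.lean`), so by
`hBox` it carries the level structures of `X(b3,b5)` or of `X(s3,b5)`; by `hX₁`/`hX₂` and the
rationality of all `K`-points of `E₁`, `E₂`, `j(E) = j₀ ∈ ℚ`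
(`Thorne2019.exists_ratCast_eq_of_pointsRational`). If `j₀ ∈ {0, 1728}` the curve has geometric CM
(`WeierstrassCurve.HasCM.of_j_eq_zero`, `.of_j_eq_1728`), hence is modular in the
Caraiani–Newton sense; otherwise `E` is a quadratic twist of the base change of a curve over `ℚ`
along the cyclic, hence solvable, extension `K/ℚ`, and
`isModularEllipticCurve_of_jInvariant_eq_ratCast hBC hTw` applies. Contradiction.
[cite: Thorne2019, Lemma 3 (2) and its proof, Prop. 4] -/
theorem Thorne2019_lemma3_of_moduli (hBox : Box2022_theorem1_3)
    (hBC : isModularEllipticCurve_baseChange_rat_of_isSolvable)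
    (hTw : isModularEllipticCurve_of_jInvariant_eq)
    (hX₁ : ∃ (S : Finset ℚ) (Jn Jd : MvPolynomial (Fin 2) ℚ),
      ∀ (K : Type) [Field K] [NumberField K] (E : WeierstrassCurve (𝓞 K)), E.Δ ≠ 0 →
        (∃ ρ : FramedGaloisRep K (ZMod 3) 2, (E.baseChange K).IsTorsionGaloisRep 3 ρ ∧
            ∀ σ : absoluteGaloisGroup K,
              ((ρ σ : GL (Fin 2) (ZMod 3)) : Matrix (Fin 2) (Fin 2) (ZMod 3)) 1 0 = 0) →
        (∃ ρ : FramedGaloisRep K (ZMod 5) 2, (E.baseChange K).IsTorsionGaloisRep 5 ρ ∧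
            ∀ σ : absoluteGaloisGroup K,
              ((ρ σ : GL (Fin 2) (ZMod 5)) : Matrix (Fin 2) (Fin 2) (ZMod 5)) 1 0 = 0) →
        (∃ j₀ ∈ S, (algebraMap (𝓞 K) K E.c₄) ^ 3 / algebraMap (𝓞 K) K E.Δ = (j₀ : K)) ∨
        ∃ x y : K, (Thorne2019.E₁.baseChange K).toAffine.Equation x y ∧
          MvPolynomial.aeval ![x, y] Jd ≠ 0 ∧
          (algebraMap (𝓞 K) K E.c₄) ^ 3 / algebraMap (𝓞 K) K E.Δ * MvPolynomial.aeval ![x, y] Jd =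
            MvPolynomial.aeval ![x, y] Jn)
    (hX₂ : ∃ (S : Finset ℚ) (Jn Jd : MvPolynomial (Fin 2) ℚ),
      ∀ (K : Type) [Field K] [NumberField K] (E : WeierstrassCurve (𝓞 K)), E.Δ ≠ 0 →
        (∃ ρ : FramedGaloisRep K (ZMod 3) 2, (E.baseChange K).IsTorsionGaloisRep 3 ρ ∧
            ∀ σ : absoluteGaloisGroup K, (ρ σ : GL (Fin 2) (ZMod 3)) ∈
              Subgroup.closure ({(⟨!![1, 0; 0, 2], !![1, 0; 0, 2], by decide, by decide⟩ :
                  GL (Fin 2) (ZMod 3)),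
                (⟨!![0, 1; 1, 0], !![0, 1; 1, 0], by decide, by decide⟩ : GL (Fin 2) (ZMod 3))} :
                Set (GL (Fin 2) (ZMod 3)))) →
        (∃ ρ : FramedGaloisRep K (ZMod 5) 2, (E.baseChange K).IsTorsionGaloisRep 5 ρ ∧
            ∀ σ : absoluteGaloisGroup K,
              ((ρ σ : GL (Fin 2) (ZMod 5)) : Matrix (Fin 2) (Fin 2) (ZMod 5)) 1 0 = 0) →
        (∃ j₀ ∈ S, (algebraMap (𝓞 K) K E.c₄) ^ 3 / algebraMap (𝓞 K) K E.Δ = (j₀ : K)) ∨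
        ∃ x y : K, (Thorne2019.E₂.baseChange K).toAffine.Equation x y ∧
          MvPolynomial.aeval ![x, y] Jd ≠ 0 ∧
          (algebraMap (𝓞 K) K E.c₄) ^ 3 / algebraMap (𝓞 K) K E.Δ * MvPolynomial.aeval ![x, y] Jd =
            MvPolynomial.aeval ![x, y] Jn) :
    Thorne2019_lemma3 := by
  intro K _ _ hK h5 hG hC h₁ h₂ E hΔ
  haveI := hK
  haveI := hG
  haveI := hC
  haveI : IsSolvable (K ≃ₐ[ℚ] K) := isSolvable_of_comm mul_comm'
  by_contra hE
  -- part (1): level structures of a non-modular curve (`Box2022_theorem1_3` (i), (ii))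
  have hnA : ¬ IsAutomorphicOfWeightZero E :=
    not_isAutomorphicOfWeightZero_of_not_isModularEllipticCurve hΔ hE
  obtain ⟨⟨ρ₃, hρ₃, h3⟩, h5', -⟩ := hBox K E hΔ hnA
  obtain ⟨ρ₅, hρ₅, hb5⟩ := h5' h5
  -- the moduli interpretation and `X(K) = X(ℚ)`: `j(E)` is rational
  have hjrat : ∃ j₀ : ℚ, (algebraMap (𝓞 K) K E.c₄) ^ 3 / algebraMap (𝓞 K) K E.Δ = (j₀ : K) := by
    rcases h3 with hb3 | hs3
    · obtain ⟨S, Jn, Jd, hX⟩ := hX₁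
      rcases hX K E hΔ ⟨ρ₃, hρ₃, hb3⟩ ⟨ρ₅, hρ₅, hb5⟩ with ⟨j₀, -, hj⟩ | ⟨x, y, hxy, hJd, hJ⟩
      · exact ⟨j₀, hj⟩
      · exact Thorne2019.exists_ratCast_eq_of_pointsRational h₁ hxy hJd hJ
    · obtain ⟨S, Jn, Jd, hX⟩ := hX₂
      rcases hX K E hΔ ⟨ρ₃, hρ₃, hs3⟩ ⟨ρ₅, hρ₅, hb5⟩ with ⟨j₀, -, hj⟩ | ⟨x, y, hxy, hJd, hJ⟩
      · exact ⟨j₀, hj⟩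
      · exact Thorne2019.exists_ratCast_eq_of_pointsRational h₂ hxy hJd hJ
  obtain ⟨j₀, hj⟩ := hjrat
  -- `j ∈ {0, 1728}`: geometric CM, hence modular in the Caraiani–Newton sense
  letI := FLS2015.isElliptic_baseChange (K := K) hΔ
  have hjK : (E.baseChange K).j = (j₀ : K) := (j_baseChange_eq_div hΔ).trans hj
  by_cases h0 : j₀ = 0
  · refine hE (IsModularEllipticCurve.of_hasCM (WeierstrassCurve.HasCM.of_j_eq_zero ?_))
    rw [hjK, h0, Rat.cast_zero]
  by_cases h1728 : j₀ = 1728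
  · refine hE (IsModularEllipticCurve.of_hasCM (WeierstrassCurve.HasCM.of_j_eq_1728 ?_))
    rw [hjK, h1728]
    norm_num
  -- `j ∉ {0, 1728}`: BCDT + cyclic base change + quadratic twist
  exact hE (isModularEllipticCurve_of_jInvariant_eq_ratCast hBC hTw K E hΔ j₀ h0 h1728 hj)

/-! ### 2c. The moduli interpretation of `X(b3, b5) = X₀(15) ≅ E₁` (hypothesis `hX₁`), proved -/

namespace Thorne2019

open scoped Classical in
/-- **A `B(p)`-framing gives a Galois-stable cyclic subgroup.** If the framed mod-`p` representation
`ρ̄` of `W` (`IsTorsionGaloisRep`: `e(σP) = ρ̄(σ) e(P)` for a frame `e : E[p] ≃ (ℤ/p)²`) has all its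
matrices with `(1,0)`-entry `0` (upper triangular: image in the Borel `B(p)`), then the point
`P = e⁻¹(1, 0) ∈ E[p](K̄)` is non-zero, killed by `p`, and every `σ ∈ Gal(K̄/K)` maps `P` to a
multiple `a P`, `a = ρ̄(σ)₀₀`. (Silverman, *AEC* III.7–8: a rational cyclic subgroup of order `p` is
the same as a Borel mod-`p` image.) [folklore] -/
theorem exists_point_of_isTorsionGaloisRep_borel {K : Type} [Field K] (W : WeierstrassCurve K)
    {p : ℕ} [Fact p.Prime] {ρ : FramedGaloisRep K (ZMod p) 2} (hρ : W.IsTorsionGaloisRep p ρ)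
    (hB : ∀ σ : absoluteGaloisGroup K,
      ((ρ σ : GL (Fin 2) (ZMod p)) : Matrix (Fin 2) (Fin 2) (ZMod p)) 1 0 = 0) :
    ∃ P : W.geomPoints, P ≠ 0 ∧ p • P = 0 ∧
      ∀ σ : absoluteGaloisGroup K, ∃ a : ℕ, a < p ∧ σ • P = a • P := by
  obtain ⟨e, he⟩ := hρ
  obtain ⟨P₀, hP₀⟩ : ∃ P₀ : W.geomTorsion p, e P₀ = Pi.single 0 1 :=
    ⟨e.symm _, e.apply_symm_apply _⟩
  refine ⟨(P₀ : W.geomPoints), ?_, ?_, ?_⟩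
  · intro h0
    have : P₀ = 0 := Subtype.ext h0
    rw [this, map_zero] at hP₀
    have h1 := congrFun hP₀ 0
    simp at h1
  · have h := P₀.2
    change ((p : ℕ) : ℤ) • (P₀ : W.geomPoints) = 0 at h
    rwa [natCast_zsmul] at h
  · intro σ
    obtain ⟨M, hM⟩ : ∃ M : Matrix (Fin 2) (Fin 2) (ZMod p),
        M = ((ρ σ : GL (Fin 2) (ZMod p)) : Matrix (Fin 2) (Fin 2) (ZMod p)) := ⟨_, rfl⟩
    have hM10 : M 1 0 = 0 := by rw [hM]; exact hB σ
    have hσ := he σ P₀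
    rw [hP₀, ← hM] at hσ
    have hv : Matrix.mulVec M (Pi.single 0 1) = (M 0 0).val • (Pi.single 0 1 : Fin 2 → ZMod p) := by
      ext i
      fin_cases i
      · simp [Matrix.mulVec, dotProduct, Fin.sum_univ_two, nsmul_eq_mul]
      · simp [Matrix.mulVec, dotProduct, Fin.sum_univ_two, hM10]
    rw [hv, ← hP₀, ← map_nsmul] at hσ
    refine ⟨(M 0 0).val, ZMod.val_lt _, ?_⟩
    have := congrArg Subtype.val (e.injective hσ)
    rwa [AddSubgroupClass.coe_nsmul] at this

open scoped Classical in
/-- A `B(3)`-framing gives `P ∈ E[3](K̄)`, `P ≠ O`, `2P = -P`, with `σP = ±P` for all `σ`.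
[folklore] -/
theorem exists_point_of_isTorsionGaloisRep_borel_three {K : Type} [Field K]
    (W : WeierstrassCurve K) {ρ : FramedGaloisRep K (ZMod 3) 2} (hρ : W.IsTorsionGaloisRep 3 ρ)
    (hB : ∀ σ : absoluteGaloisGroup K,
      ((ρ σ : GL (Fin 2) (ZMod 3)) : Matrix (Fin 2) (Fin 2) (ZMod 3)) 1 0 = 0) :
    ∃ P : W.geomPoints, P ≠ 0 ∧ P + P = -P ∧
      ∀ σ : absoluteGaloisGroup K, σ • P = P ∨ σ • P = -P := by
  obtain ⟨P, hP0, h3, hσ⟩ := exists_point_of_isTorsionGaloisRep_borel W hρ hB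
  have h2 : P + P = -P := by
    apply eq_neg_of_add_eq_zero_left
    simpa only [succ_nsmul, zero_nsmul, zero_add] using h3
  refine ⟨P, hP0, h2, fun σ => ?_⟩
  obtain ⟨a, ha, hσa⟩ := hσ σ
  interval_cases a
  · rw [zero_nsmul, smul_eq_zero_iff_eq] at hσa
    exact absurd hσa hP0
  · exact Or.inl (by rwa [one_nsmul] at hσa)
  · exact Or.inr (by rwa [two_nsmul, h2] at hσa)

open scoped Classical in
/-- A `B(5)`-framing gives `P ∈ E[5](K̄)`, `P ≠ O`, `2P ≠ -P`, `4P = -P`, with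
`σP ∈ {±P, ±2P}` for all `σ`. [folklore] -/
theorem exists_point_of_isTorsionGaloisRep_borel_five {K : Type} [Field K]
    (W : WeierstrassCurve K) {ρ : FramedGaloisRep K (ZMod 5) 2} (hρ : W.IsTorsionGaloisRep 5 ρ)
    (hB : ∀ σ : absoluteGaloisGroup K,
      ((ρ σ : GL (Fin 2) (ZMod 5)) : Matrix (Fin 2) (Fin 2) (ZMod 5)) 1 0 = 0) :
    ∃ P : W.geomPoints, P ≠ 0 ∧ P + P ≠ -P ∧ P + P + (P + P) = -P ∧
      ∀ σ : absoluteGaloisGroup K,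
        σ • P = P ∨ σ • P = -P ∨ σ • P = P + P ∨ σ • P = -(P + P) := by
  haveI : Fact (Nat.Prime 5) := ⟨by norm_num⟩
  obtain ⟨P, hP0, h5, hσ⟩ := exists_point_of_isTorsionGaloisRep_borel W hρ hB
  have h5' : P + P + (P + P) + P = 0 := by
    simpa only [succ_nsmul, zero_nsmul, zero_add, add_assoc] using h5
  have h4 : P + P + (P + P) = -P := eq_neg_of_add_eq_zero_left h5'
  have hne : P + P ≠ -P := by
    intro h
    rw [h, add_eq_left, neg_eq_zero] at h4
    exact hP0 h4
  refine ⟨P, hP0, hne, h4, fun σ => ?_⟩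
  obtain ⟨a, ha, hσa⟩ := hσ σ
  interval_cases a
  · rw [zero_nsmul, smul_eq_zero_iff_eq] at hσa
    exact absurd hσa hP0
  · exact Or.inl (by rwa [one_nsmul] at hσa)
  · exact Or.inr (Or.inr (Or.inl (by rwa [two_nsmul] at hσa)))
  · -- `3P = -2P`
    have h3 : (3 : ℕ) • P = -(P + P) := by
      apply eq_neg_of_add_eq_zero_left
      simpa only [succ_nsmul, zero_nsmul, zero_add, add_assoc] using h5'
    exact Or.inr (Or.inr (Or.inr (by rwa [h3] at hσa)))
  · -- `4P = -P`
    have h4' : (4 : ℕ) • P = -P := by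
      rw [← h4]
      simp only [succ_nsmul, zero_nsmul, zero_add, add_assoc]
    exact Or.inr (Or.inl (by rwa [h4'] at hσa))

open scoped Classical in
/-- Frames: if `e(σR) = a · e(T)` for `3`-torsion points with `R ≠ O`, then `σR = ±T`
(`a ∈ {1, 2} = {±1} ⊂ 𝔽₃`, `2T = -T`). [folklore] -/
theorem smul_eq_or_eq_neg_of_frame {K : Type} [Field K] {W : WeierstrassCurve K}
    (e : W.geomTorsion 3 ≃+ (Fin 2 → ZMod 3)) {σ : absoluteGaloisGroup K}
    {R T : W.geomTorsion 3} (hR : (R : W.geomPoints) ≠ 0) {a : ZMod 3}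
    (h : e (σ • R) = a • e T) :
    σ • (R : W.geomPoints) = T ∨ σ • (R : W.geomPoints) = -T := by
  have hT3 : (T : W.geomPoints) + T + T = 0 := by
    have h3 := T.2
    change ((3 : ℕ) : ℤ) • (T : W.geomPoints) = 0 at h3
    simpa only [natCast_zsmul, succ_nsmul, zero_nsmul, zero_add] using h3
  have ha : a • e T = e (a.val • T) := by
    rw [map_nsmul, ← Nat.cast_smul_eq_nsmul (ZMod 3), ZMod.natCast_zmod_val]
  rw [ha] at h
  have hRT := congrArg Subtype.val (e.injective h)
  rw [AddSubgroupClass.coe_nsmul] at hRT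
  change σ • (R : W.geomPoints) = a.val • (T : W.geomPoints) at hRT
  have hval := ZMod.val_lt a
  revert hRT hval
  generalize a.val = n
  intro hRT hn
  interval_cases n
  · rw [zero_nsmul, smul_eq_zero_iff_eq] at hRT
    exact absurd hRT hR
  · exact Or.inl (by rwa [one_nsmul] at hRT)
  · right
    rw [hRT, two_nsmul]
    exact eq_neg_of_add_eq_zero_left hT3

open scoped Classical in
/-- **A `C_s⁺(3)`-framing gives a Galois-stable pair of cyclic subgroups of order `3`.** If the
framed mod-`3` representation has image in the normaliser of the split Cartan subgroup
(generated by `diag(1, 2)` and the flip `antidiag(1, 1)`: the monomial matrices), then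
`P = e⁻¹(1,0)`, `Q = e⁻¹(0,1)` are non-zero `3`-torsion points and every `σ` maps
`(P, Q) ↦ (±P, ±Q)` (diagonal `ρ̄(σ)`) or `(P, Q) ↦ (±Q, ±P)` (antidiagonal `ρ̄(σ)`).
[folklore] -/
theorem exists_pair_of_isTorsionGaloisRep_splitCartan {K : Type} [Field K]
    (W : WeierstrassCurve K) {ρ : FramedGaloisRep K (ZMod 3) 2} (hρ : W.IsTorsionGaloisRep 3 ρ)
    (hN : ∀ σ : absoluteGaloisGroup K, (ρ σ : GL (Fin 2) (ZMod 3)) ∈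
      Subgroup.closure ({(⟨!![1, 0; 0, 2], !![1, 0; 0, 2], by decide, by decide⟩ :
          GL (Fin 2) (ZMod 3)),
        (⟨!![0, 1; 1, 0], !![0, 1; 1, 0], by decide, by decide⟩ : GL (Fin 2) (ZMod 3))} :
        Set (GL (Fin 2) (ZMod 3)))) :
    ∃ P Q : W.geomPoints, P ≠ 0 ∧ P + P = -P ∧ Q ≠ 0 ∧ Q + Q = -Q ∧
      ∀ σ : absoluteGaloisGroup K,
        ((σ • P = P ∨ σ • P = -P) ∧ (σ • Q = Q ∨ σ • Q = -Q)) ∨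
          ((σ • P = Q ∨ σ • P = -Q) ∧ (σ • Q = P ∨ σ • Q = -P)) := by
  -- the closure consists of monomial matrices
  have key : ∀ g ∈ Subgroup.closure ({(⟨!![1, 0; 0, 2], !![1, 0; 0, 2], by decide, by decide⟩ :
          GL (Fin 2) (ZMod 3)),
        (⟨!![0, 1; 1, 0], !![0, 1; 1, 0], by decide, by decide⟩ : GL (Fin 2) (ZMod 3))} :
        Set (GL (Fin 2) (ZMod 3))),
      ((g : Matrix (Fin 2) (Fin 2) (ZMod 3)) 0 1 = 0 ∧
          (g : Matrix (Fin 2) (Fin 2) (ZMod 3)) 1 0 = 0) ∨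
        ((g : Matrix (Fin 2) (Fin 2) (ZMod 3)) 0 0 = 0 ∧
          (g : Matrix (Fin 2) (Fin 2) (ZMod 3)) 1 1 = 0) := by
    intro g hg
    induction hg using Subgroup.closure_induction with
    | mem g hg =>
      rcases hg with rfl | rfl
      · left; exact ⟨rfl, rfl⟩
      · right; exact ⟨rfl, rfl⟩
    | one => left; exact ⟨rfl, rfl⟩
    | mul a b _ _ iha ihb =>
      rw [Units.val_mul]
      rcases iha with ⟨ha1, ha2⟩ | ⟨ha1, ha2⟩ <;> rcases ihb with ⟨hb1, hb2⟩ | ⟨hb1, hb2⟩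
      · left; simp [Matrix.mul_apply, Fin.sum_univ_two, ha1, ha2, hb1, hb2]
      · right; simp [Matrix.mul_apply, Fin.sum_univ_two, ha1, ha2, hb1, hb2]
      · right; simp [Matrix.mul_apply, Fin.sum_univ_two, ha1, ha2, hb1, hb2]
      · left; simp [Matrix.mul_apply, Fin.sum_univ_two, ha1, ha2, hb1, hb2]
    | inv a _ iha =>
      rw [Matrix.coe_units_inv, Matrix.inv_def, Matrix.adjugate_fin_two]
      rcases iha with ⟨ha1, ha2⟩ | ⟨ha1, ha2⟩
      · left; simp [ha1, ha2]
      · right; simp [ha1, ha2]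
  obtain ⟨e, he⟩ := hρ
  obtain ⟨P₀, hP₀⟩ : ∃ P₀ : W.geomTorsion 3, e P₀ = Pi.single 0 1 :=
    ⟨e.symm _, e.apply_symm_apply _⟩
  obtain ⟨Q₀, hQ₀⟩ : ∃ Q₀ : W.geomTorsion 3, e Q₀ = Pi.single 1 1 :=
    ⟨e.symm _, e.apply_symm_apply _⟩
  have h3 : ∀ T : W.geomTorsion 3, (T : W.geomPoints) + T = -T := by
    intro T
    have hT := T.2
    change ((3 : ℕ) : ℤ) • (T : W.geomPoints) = 0 at hT
    apply eq_neg_of_add_eq_zero_left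
    simpa only [natCast_zsmul, succ_nsmul, zero_nsmul, zero_add] using hT
  have hne : ∀ T : W.geomTorsion 3, (∃ i, e T i ≠ 0) → (T : W.geomPoints) ≠ 0 := by
    rintro T ⟨i, hi⟩ h0
    have : T = 0 := Subtype.ext h0
    rw [this, map_zero] at hi
    exact hi rfl
  have hP : (P₀ : W.geomPoints) ≠ 0 := hne P₀ ⟨0, by rw [hP₀]; decide⟩
  have hQ : (Q₀ : W.geomPoints) ≠ 0 := hne Q₀ ⟨1, by rw [hQ₀]; decide⟩
  refine ⟨P₀, Q₀, hP, h3 P₀, hQ, h3 Q₀, fun σ => ?_⟩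
  obtain ⟨M, hM⟩ : ∃ M : Matrix (Fin 2) (Fin 2) (ZMod 3),
      M = ((ρ σ : GL (Fin 2) (ZMod 3)) : Matrix (Fin 2) (Fin 2) (ZMod 3)) := ⟨_, rfl⟩
  have hσP := he σ P₀
  have hσQ := he σ Q₀
  rw [hP₀, ← hM] at hσP
  rw [hQ₀, ← hM] at hσQ
  have hcol0 : Matrix.mulVec M (Pi.single 0 1) = ![M 0 0, M 1 0] := by
    ext i; fin_cases i <;> simp [Matrix.mulVec, dotProduct, Fin.sum_univ_two]
  have hcol1 : Matrix.mulVec M (Pi.single 1 1) = ![M 0 1, M 1 1] := by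
    ext i; fin_cases i <;> simp [Matrix.mulVec, dotProduct, Fin.sum_univ_two]
  rw [hcol0] at hσP
  rw [hcol1] at hσQ
  rcases key _ (hN σ) with ⟨h01, h10⟩ | ⟨h00, h11⟩
  · rw [← hM] at h01 h10
    left
    constructor
    · apply smul_eq_or_eq_neg_of_frame e hP (T := P₀) (a := M 0 0)
      rw [hσP, hP₀, h10]
      ext i; fin_cases i <;> simp
    · apply smul_eq_or_eq_neg_of_frame e hQ (T := Q₀) (a := M 1 1)
      rw [hσQ, hQ₀, h01]
      ext i; fin_cases i <;> simp
  · rw [← hM] at h00 h11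
    right
    constructor
    · apply smul_eq_or_eq_neg_of_frame e hP (T := Q₀) (a := M 1 0)
      rw [hσP, hQ₀, h00]
      ext i; fin_cases i <;> simp
    · apply smul_eq_or_eq_neg_of_frame e hQ (T := P₀) (a := M 0 1)
      rw [hσQ, hP₀, h11]
      ext i; fin_cases i <;> simp

/-- **The moduli interpretation of `X(b3, b5) = X₀(15) ≅ E₁` — hypothesis `hX₁` of
`Thorne2019_lemma3_of_moduli`, proved.** For every number field `K` and every `E / 𝓞 K` with
`Δ ≠ 0` carrying a `B(3)`-framing of `E[3]` and a `B(5)`-framing of `E[5]`, either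
`j(E) ∈ {0, 1728}` or there is a `K`-rational affine point `(x, y)` of `E₁` at which the rational
function `J = (N² + 10NB + 5B²)³/(N B⁵)`, `N = -125(x+1)²`, `B = 6(x-2)(x+1) + (x+10)(y+x+1)`, is
defined and takes the value `j(E)`. Proof: the framings give Galois-stable cyclic subgroups of
orders `3` and `5` (`exists_point_of_isTorsionGaloisRep_borel_three/five`), hence `K`-rational
Hauptmodul values `F`, `H ≠ 0` of `X₀(3)`, `X₀(5)` over `j(E)`
(`WeierstrassCurve.exists_hauptmodul_three/five_of_torsion`, Tate normal forms and Galois descent),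
hence a `K`-point of `E₁` by the certified explicit isomorphism `X₀(15) ≅ E₁`
(`XZeroFifteen.exists_point`). [cite: Thorne2019, proof of Lemma 3 ("`X(b3, b5)` … isomorphic to
`E₁`") and Prop. 4] -/
theorem moduli_X0_15 :
    ∃ (S : Finset ℚ) (Jn Jd : MvPolynomial (Fin 2) ℚ),
      ∀ (K : Type) [Field K] [NumberField K] (E : WeierstrassCurve (𝓞 K)), E.Δ ≠ 0 →
        (∃ ρ : FramedGaloisRep K (ZMod 3) 2, (E.baseChange K).IsTorsionGaloisRep 3 ρ ∧
            ∀ σ : absoluteGaloisGroup K,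
              ((ρ σ : GL (Fin 2) (ZMod 3)) : Matrix (Fin 2) (Fin 2) (ZMod 3)) 1 0 = 0) →
        (∃ ρ : FramedGaloisRep K (ZMod 5) 2, (E.baseChange K).IsTorsionGaloisRep 5 ρ ∧
            ∀ σ : absoluteGaloisGroup K,
              ((ρ σ : GL (Fin 2) (ZMod 5)) : Matrix (Fin 2) (Fin 2) (ZMod 5)) 1 0 = 0) →
        (∃ j₀ ∈ S, (algebraMap (𝓞 K) K E.c₄) ^ 3 / algebraMap (𝓞 K) K E.Δ = (j₀ : K)) ∨
        ∃ x y : K, (Thorne2019.E₁.baseChange K).toAffine.Equation x y ∧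
          MvPolynomial.aeval ![x, y] Jd ≠ 0 ∧
          (algebraMap (𝓞 K) K E.c₄) ^ 3 / algebraMap (𝓞 K) K E.Δ * MvPolynomial.aeval ![x, y] Jd =
            MvPolynomial.aeval ![x, y] Jn := by
  classical
  -- `N = -125 (X+1)²`, `B = 6(X-2)(X+1) + (X+10)(Y+X+1)` in `ℚ[X, Y]`
  refine ⟨{0, 1728},
    ((MvPolynomial.C (-125) * (MvPolynomial.X 0 + 1) ^ 2) ^ 2 +
        10 * (MvPolynomial.C (-125) * (MvPolynomial.X 0 + 1) ^ 2) *
          (6 * (MvPolynomial.X 0 - 2) * (MvPolynomial.X 0 + 1) +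
            (MvPolynomial.X 0 + 10) * (MvPolynomial.X 1 + MvPolynomial.X 0 + 1)) +
      5 * (6 * (MvPolynomial.X 0 - 2) * (MvPolynomial.X 0 + 1) +
            (MvPolynomial.X 0 + 10) * (MvPolynomial.X 1 + MvPolynomial.X 0 + 1)) ^ 2) ^ 3,
    MvPolynomial.C (-125) * (MvPolynomial.X 0 + 1) ^ 2 *
      (6 * (MvPolynomial.X 0 - 2) * (MvPolynomial.X 0 + 1) +
        (MvPolynomial.X 0 + 10) * (MvPolynomial.X 1 + MvPolynomial.X 0 + 1)) ^ 5,
    fun K _ _ E hΔ h3 h5 => ?_⟩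
  obtain ⟨ρ₃, hρ₃, hB₃⟩ := h3
  obtain ⟨ρ₅, hρ₅, hB₅⟩ := h5
  letI := FLS2015.isElliptic_baseChange hΔ
  haveI : IsGalois K (AlgebraicClosure K) := {}
  have hj := j_baseChange_eq_div hΔ
  -- Galois-stable cyclic subgroups of orders 3 and 5, and the Hauptmodul values
  obtain ⟨P₃, hP₃, h2P₃, hσ₃⟩ := exists_point_of_isTorsionGaloisRep_borel_three _ hρ₃ hB₃
  obtain ⟨f, -, hjf⟩ :=
    WeierstrassCurve.exists_hauptmodul_three_of_torsion (E.baseChange K) (P := P₃) hP₃ h2P₃ hσ₃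
  obtain ⟨P₅, hP₅, hne₅, h4P₅, hσ₅⟩ := exists_point_of_isTorsionGaloisRep_borel_five _ hρ₅ hB₅
  obtain ⟨g, hg0, hjg⟩ :=
    WeierstrassCurve.exists_hauptmodul_five_of_torsion (E.baseChange K) (P := P₅) hP₅ hne₅ h4P₅
      hσ₅
  rw [hj] at hjf hjg
  -- the explicit isomorphism `X₀(15) ≅ E₁`
  rcases Literature.NumberTheory.EllipticCurves.XZeroFifteen.exists_point hg0 hjf hjg with
    h0 | h1728 | ⟨x, y, hxy, hJd, hJ⟩
  · exact Or.inl ⟨0, by simp, by rw [h0, Rat.cast_zero]⟩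
  · exact Or.inl ⟨1728, by simp, by rw [h1728]; norm_cast⟩
  · refine Or.inr ⟨x, y, ?_, ?_, ?_⟩
    · rw [WeierstrassCurve.Affine.equation_iff]
      simp only [E₁, WeierstrassCurve.baseChange, WeierstrassCurve.map, map_one, map_neg,
        map_ofNat, one_mul]
      linear_combination hxy
    · simpa [MvPolynomial.aeval_C, map_neg] using hJd
    · simpa [MvPolynomial.aeval_C, map_neg] using hJ

end Thorne2019

/-! ### 2d. Lemma 3 (2) from the named facts `Box2022_theorem1_3`, solvable base change, and the
moduli interpretation of `X(s3, b5)` only -/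

/-- **Thorne 2019, Lemma 3 (2), modulo `Box2022_theorem1_3`, cyclic base change and the moduli
interpretation of `X(s3, b5) ≅ E₂`.** Of the five inputs of `Thorne2019_lemma3_of_moduli`, two are
now theorems: the quadratic-twist fact `isModularEllipticCurve_of_jInvariant_eq`
(`isModularEllipticCurve_of_jInvariant_eq_holds`) and the moduli interpretation of
`X(b3, b5) = X₀(15) ≅ E₁` (`Thorne2019.moduli_X0_15`). [cite: Thorne2019, Lemma 3 (2), Prop. 4] -/
theorem Thorne2019_lemma3_of_facts_of_moduli_Xs3b5 (hBox : Box2022_theorem1_3)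
    (hBC : isModularEllipticCurve_baseChange_rat_of_isSolvable)
    (hX₂ : ∃ (S : Finset ℚ) (Jn Jd : MvPolynomial (Fin 2) ℚ),
      ∀ (K : Type) [Field K] [NumberField K] (E : WeierstrassCurve (𝓞 K)), E.Δ ≠ 0 →
        (∃ ρ : FramedGaloisRep K (ZMod 3) 2, (E.baseChange K).IsTorsionGaloisRep 3 ρ ∧
            ∀ σ : absoluteGaloisGroup K, (ρ σ : GL (Fin 2) (ZMod 3)) ∈
              Subgroup.closure ({(⟨!![1, 0; 0, 2], !![1, 0; 0, 2], by decide, by decide⟩ :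
                  GL (Fin 2) (ZMod 3)),
                (⟨!![0, 1; 1, 0], !![0, 1; 1, 0], by decide, by decide⟩ : GL (Fin 2) (ZMod 3))} :
                Set (GL (Fin 2) (ZMod 3)))) →
        (∃ ρ : FramedGaloisRep K (ZMod 5) 2, (E.baseChange K).IsTorsionGaloisRep 5 ρ ∧
            ∀ σ : absoluteGaloisGroup K,
              ((ρ σ : GL (Fin 2) (ZMod 5)) : Matrix (Fin 2) (Fin 2) (ZMod 5)) 1 0 = 0) →
        (∃ j₀ ∈ S, (algebraMap (𝓞 K) K E.c₄) ^ 3 / algebraMap (𝓞 K) K E.Δ = (j₀ : K)) ∨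
        ∃ x y : K, (Thorne2019.E₂.baseChange K).toAffine.Equation x y ∧
          MvPolynomial.aeval ![x, y] Jd ≠ 0 ∧
          (algebraMap (𝓞 K) K E.c₄) ^ 3 / algebraMap (𝓞 K) K E.Δ * MvPolynomial.aeval ![x, y] Jd =
            MvPolynomial.aeval ![x, y] Jn) :
    Thorne2019_lemma3 :=
  Thorne2019_lemma3_of_moduli hBox hBC isModularEllipticCurve_of_jInvariant_eq_holds
    Thorne2019.moduli_X0_15 hX₂

/-! ### 2e. The moduli interpretation of `X(s3, b5) ≅ E₂` made explicit, and Lemma 3 (2) from the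
two named facts `Box2022_theorem1_3` and solvable base change only -/

namespace Thorne2019

/-- A field element that is a rational function (over `ℚ`) of rational numbers is rational:
if `j · d = n` with `d, n ∈ ℚ`, `d ≠ 0`, then `j ∈ ℚ`. [folklore] -/
theorem exists_ratCast_of_mul_eq {K : Type*} [Field K] [CharZero K] {j : K} {d n : ℚ}
    (hd : (d : K) ≠ 0) (h : j * d = n) : ∃ j₀ : ℚ, j = (j₀ : K) :=
  ⟨n / d, by rw [Rat.cast_div, eq_div_iff hd, h]⟩

open scoped Classical in
/-- **`j(E) ∈ ℚ` in the case `C_s⁺(3)`, `B(5)` of Thorne's Lemma 3 (2).** Let `K` be a number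
field with `E₁(K) = E₁(ℚ)` and `E₂(K) = E₂(ℚ)`, and `E/K` an elliptic curve whose mod-`3`
representation has image in the normaliser of a split Cartan subgroup and whose mod-`5`
representation is Borel (framings as produced by `Box2022_theorem1_3`). Then `j(E) ∈ ℚ`.
Proof (Thorne): `E` gives a `K`-point of `X(s3, b5) ≅ E₂` — or, when the two Galois-stable
`3`-lines happen to be individually stable with the same Hauptmodul value, of `X₀(15) ≅ E₁` — made
explicit by `TorsionPointHauptmodul` (Hauptmodul values `f₀, f₁` with `f₀ + f₁, f₀ f₁ ∈ K`, and
`H ∈ K`), `XsThreeBFive.exists_point` / `XZeroFifteen.exists_point` (a `K`-point `(x, y)` of `E₂`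
resp. `E₁` at which an explicit `ℚ`-rational function recovers `H` resp. `j`); that point is
rational by hypothesis, so `H ∈ ℚ` and `j = (H² + 10H + 5)³/H ∈ ℚ`.
[cite: Thorne2019, Lemma 3 (2), proof; Prop. 4] -/
theorem exists_ratCast_j_of_splitCartan {K : Type} [Field K] [NumberField K]
    (h₁ : PointsRational E₁ K) (h₂ : PointsRational E₂ K) (E : WeierstrassCurve (𝓞 K))
    (hΔ : E.Δ ≠ 0)
    (h3 : ∃ ρ : FramedGaloisRep K (ZMod 3) 2, (E.baseChange K).IsTorsionGaloisRep 3 ρ ∧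
      ∀ σ : absoluteGaloisGroup K, (ρ σ : GL (Fin 2) (ZMod 3)) ∈
        Subgroup.closure ({(⟨!![1, 0; 0, 2], !![1, 0; 0, 2], by decide, by decide⟩ :
            GL (Fin 2) (ZMod 3)),
          (⟨!![0, 1; 1, 0], !![0, 1; 1, 0], by decide, by decide⟩ : GL (Fin 2) (ZMod 3))} :
          Set (GL (Fin 2) (ZMod 3))))
    (h5 : ∃ ρ : FramedGaloisRep K (ZMod 5) 2, (E.baseChange K).IsTorsionGaloisRep 5 ρ ∧
      ∀ σ : absoluteGaloisGroup K,
        ((ρ σ : GL (Fin 2) (ZMod 5)) : Matrix (Fin 2) (Fin 2) (ZMod 5)) 1 0 = 0) :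
    ∃ j₀ : ℚ, (algebraMap (𝓞 K) K E.c₄) ^ 3 / algebraMap (𝓞 K) K E.Δ = (j₀ : K) := by
  obtain ⟨ρ₃, hρ₃, hN₃⟩ := h3
  obtain ⟨ρ₅, hρ₅, hB₅⟩ := h5
  letI := FLS2015.isElliptic_baseChange hΔ
  haveI : IsGalois K (AlgebraicClosure K) := {}
  have hj := j_baseChange_eq_div hΔ
  -- the Galois-stable pair of `3`-lines and the two Hauptmodul values; the `5`-line and `H`
  obtain ⟨P, Q, hP, hP3, hQ, hQ3, hσ⟩ := exists_pair_of_isTorsionGaloisRep_splitCartan _ hρ₃ hN₃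
  obtain ⟨s, z, f₀, f₁, hs, hz, -, -, hjf₀, hjf₁⟩ :=
    WeierstrassCurve.exists_hauptmodul_pair_three_of_torsion (E.baseChange K) (P := P) (Q := Q)
      hP hP3 hQ hQ3 hσ
  obtain ⟨P₅, hP₅, hne₅, h4P₅, hσ₅⟩ := exists_point_of_isTorsionGaloisRep_borel_five _ hρ₅ hB₅
  obtain ⟨g, hg0, hjg⟩ :=
    WeierstrassCurve.exists_hauptmodul_five_of_torsion (E.baseChange K) (P := P₅) hP₅ hne₅ h4P₅
      hσ₅
  rw [hj] at hjf₀ hjf₁ hjg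
  -- once `H = g ∈ ℚ`, `j = (g² + 10g + 5)³/g ∈ ℚ`
  have hfin : (∃ g₀ : ℚ, g = (g₀ : K)) →
      ∃ j₀ : ℚ, (algebraMap (𝓞 K) K E.c₄) ^ 3 / algebraMap (𝓞 K) K E.Δ = (j₀ : K) := by
    rintro ⟨g₀, rfl⟩
    exact exists_ratCast_of_mul_eq (d := g₀) (n := (g₀ ^ 2 + 10 * g₀ + 5) ^ 3) hg0
      (by push_cast; exact hjg)
  have hE₁ : ∀ x y : K, y ^ 2 + x * y + y = x ^ 3 + x ^ 2 - 10 * x - 10 →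
      (E₁.baseChange K).toAffine.Equation x y := fun x y hxy => by
    rw [WeierstrassCurve.Affine.equation_iff]
    simp only [E₁, WeierstrassCurve.baseChange, WeierstrassCurve.map, map_one, map_neg, map_ofNat,
      one_mul]
    linear_combination hxy
  have hE₂ : ∀ x y : K, y ^ 2 + x * y + y = x ^ 3 + x ^ 2 - 5 * x + 2 →
      (E₂.baseChange K).toAffine.Equation x y := fun x y hxy => by
    rw [WeierstrassCurve.Affine.equation_iff]
    simp only [E₂, WeierstrassCurve.baseChange, WeierstrassCurve.map, map_one, map_neg, map_ofNat,
      one_mul]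
    linear_combination hxy
  by_cases hne : f₀ = f₁
  · -- both `3`-lines have the same, hence `K`-rational, Hauptmodul value: a point of `X₀(15)`
    subst hne
    have hf : algebraMap K (AlgebraicClosure K) (s / 2) = f₀ := by
      rw [map_div₀, hs, map_ofNat]
      ring
    have hjf : (algebraMap (𝓞 K) K E.c₄) ^ 3 / algebraMap (𝓞 K) K E.Δ * (s / 2) =
        (s / 2 + 27) * (s / 2 + 3) ^ 3 := by
      apply (algebraMap K (AlgebraicClosure K)).injective
      simp only [map_mul, map_add, map_pow, map_ofNat, hf]
      exact hjf₀
    rcases Literature.NumberTheory.EllipticCurves.XZeroFifteen.exists_point hg0 hjf hjg with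
      h0 | h1728 | ⟨x, y, hxy, hJd, hJ⟩
    · exact ⟨0, by rw [h0, Rat.cast_zero]⟩
    · exact ⟨1728, by rw [h1728]; norm_cast⟩
    · obtain ⟨⟨qx, hqx⟩, ⟨qy, hqy⟩⟩ := h₁ x y (hE₁ x y hxy)
      rw [eq_ratCast] at hqx hqy
      subst hqx hqy
      exact exists_ratCast_of_mul_eq
        (d := -125 * (qx + 1) ^ 2 * (6 * (qx - 2) * (qx + 1) + (qx + 10) * (qy + qx + 1)) ^ 5)
        (n := ((-125 * (qx + 1) ^ 2) ^ 2 +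
          10 * (-125 * (qx + 1) ^ 2) * (6 * (qx - 2) * (qx + 1) + (qx + 10) * (qy + qx + 1)) +
          5 * (6 * (qx - 2) * (qx + 1) + (qx + 10) * (qy + qx + 1)) ^ 2) ^ 3)
        (by exact_mod_cast hJd) (by exact_mod_cast hJ)
  · -- two distinct Hauptmodul values with `f₀ + f₁, f₀ f₁ ∈ K`: a point of `X(s3, b5)`
    obtain ⟨hc', hj'⟩ :=
      Literature.NumberTheory.EllipticCurves.XsThreeBFive.cubic_of_roots hjf₀ hjf₁ hne
    rw [← hs, ← hz] at hc' hj'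
    have hc : z * (s ^ 2 + 36 * s + 270 - z) = 729 := by
      apply (algebraMap K (AlgebraicClosure K)).injective
      simp only [map_mul, map_add, map_sub, map_pow, map_ofNat]
      exact hc'
    have hjK : (algebraMap (𝓞 K) K E.c₄) ^ 3 / algebraMap (𝓞 K) K E.Δ =
        756 + s * (270 + 36 * s + s ^ 2 - z) - z * (36 + s) := by
      apply (algebraMap K (AlgebraicClosure K)).injective
      simp only [map_mul, map_add, map_sub, map_pow, map_ofNat]
      exact hj'
    rcases Literature.NumberTheory.EllipticCurves.XsThreeBFive.exists_point hg0 hc hjK hjg with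
      h0 | h1728 | ⟨x, y, hxy, hB, hHB⟩
    · exact ⟨0, by rw [h0, Rat.cast_zero]⟩
    · exact ⟨1728, by rw [h1728]; norm_cast⟩
    · obtain ⟨⟨qx, hqx⟩, ⟨qy, hqy⟩⟩ := h₂ x y (hE₂ x y hxy)
      rw [eq_ratCast] at hqx hqy
      subst hqx hqy
      exact hfin (exists_ratCast_of_mul_eq
        (d := -5 * qx ^ 3 - qx ^ 2 * qy - 29 * qx ^ 2 - 11 * qx * qy - 34 * qx - 24 * qy + 24)
        (n := 125 * qx ^ 2 + 750 * qx + 375 * qy - 375)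
        (by exact_mod_cast hB) (by exact_mod_cast hHB))

end Thorne2019

/-- **Thorne 2019, Lemma 3 (2), from the two named facts `Box2022_theorem1_3` (modularity lifting at
`3` and `5`, Thorne's Theorem 2 in the form of its level-structure dichotomy) and
`isModularEllipticCurve_baseChange_rat_of_isSolvable` (Wiles–BCDT + Langlands' cyclic base
change) only.** Everything else in Thorne's proof — the moduli interpretations
`X(b3, b5) = X₀(15) ≅ E₁` and `X(s3, b5) ≅ E₂` (made explicit and certified in
`XZeroFifteenExplicit`, `XsThreeBFiveExplicit`, fed by `TorsionPointNormalForms`,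
`TorsionPointHauptmodul`), "`X(K) = X(ℚ)` hence `j(E) ∈ ℚ`", the descent to `ℚ` by a quadratic
twist (`isModularEllipticCurve_of_jInvariant_eq_holds`) and the CM cases `j ∈ {0, 1728}` — is
proved. [cite: Thorne2019, Lemma 3 (2) and its proof, Prop. 4, Thm. 2] -/
theorem Thorne2019_lemma3_of_facts (hBox : Box2022_theorem1_3)
    (hBC : isModularEllipticCurve_baseChange_rat_of_isSolvable) : Thorne2019_lemma3 := by
  intro K _ _ hK h5 hG hC h₁ h₂ E hΔ
  haveI := hK
  haveI := hG
  haveI := hC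
  haveI : IsSolvable (K ≃ₐ[ℚ] K) := isSolvable_of_comm mul_comm'
  by_contra hE
  -- part (1): level structures of a non-modular curve (`Box2022_theorem1_3` (i), (ii))
  have hnA : ¬ IsAutomorphicOfWeightZero E :=
    not_isAutomorphicOfWeightZero_of_not_isModularEllipticCurve hΔ hE
  obtain ⟨⟨ρ₃, hρ₃, h3⟩, h5', -⟩ := hBox K E hΔ hnA
  obtain ⟨ρ₅, hρ₅, hb5⟩ := h5' h5
  -- the moduli interpretations and `X(K) = X(ℚ)`: `j(E)` is rational
  have hjrat : ∃ j₀ : ℚ, (algebraMap (𝓞 K) K E.c₄) ^ 3 / algebraMap (𝓞 K) K E.Δ = (j₀ : K) := by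
    rcases h3 with hb3 | hs3
    · obtain ⟨S, Jn, Jd, hX⟩ := Thorne2019.moduli_X0_15
      rcases hX K E hΔ ⟨ρ₃, hρ₃, hb3⟩ ⟨ρ₅, hρ₅, hb5⟩ with ⟨j₀, -, hj⟩ | ⟨x, y, hxy, hJd, hJ⟩
      · exact ⟨j₀, hj⟩
      · exact Thorne2019.exists_ratCast_eq_of_pointsRational h₁ hxy hJd hJ
    · exact Thorne2019.exists_ratCast_j_of_splitCartan h₁ h₂ E hΔ ⟨ρ₃, hρ₃, hs3⟩ ⟨ρ₅, hρ₅, hb5⟩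
  obtain ⟨j₀, hj⟩ := hjrat
  -- `j ∈ {0, 1728}`: geometric CM, hence modular in the Caraiani–Newton sense
  letI := FLS2015.isElliptic_baseChange (K := K) hΔ
  have hjK : (E.baseChange K).j = (j₀ : K) := (j_baseChange_eq_div hΔ).trans hj
  by_cases h0 : j₀ = 0
  · refine hE (IsModularEllipticCurve.of_hasCM (WeierstrassCurve.HasCM.of_j_eq_zero ?_))
    rw [hjK, h0, Rat.cast_zero]
  by_cases h1728 : j₀ = 1728
  · refine hE (IsModularEllipticCurve.of_hasCM (WeierstrassCurve.HasCM.of_j_eq_1728 ?_))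
    rw [hjK, h1728]
    norm_num
  -- `j ∉ {0, 1728}`: BCDT + cyclic base change + quadratic twist
  exact hE (isModularEllipticCurve_of_jInvariant_eq_ratCast hBC
    isModularEllipticCurve_of_jInvariant_eq_holds K E hΔ j₀ h0 h1728 hj)


end Literature.NumberTheory.Automorphic

end
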